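import Summits.NavierStokesRegularity.FluidComputer.PalasekTowerLundgrenChildWindowBand
import Summits.NavierStokesRegularity.FluidComputer.PalasekTowerBurgersNumberStrain

/-!
# REGISTER v2.3″ (continued): the any-profile STRAIN floor of a Lundgren-carried child core in register
# units — `C·x_k ≥ 16πρ·c₁` certifies the strain floor `c₁A_{k+1}`

Cell `ns-blowup`, seat `ns-blowup-ecbridge-8` (g8); evidence toward crux 19250 `HeredityFromTwo`, floor
`stub_strain_floors` (`StrainFloorAt k`: strain `≥ c₁A_{k+1}` somewhere in the ball at the readout), MODEL lane
«child core = cross-section of Lundgren's stretched flow in the host strain `λA_k` at `ν = 1`, circulation on the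
core-ledger scale `Γ ≥ C·N_{k+1}^{β−2}`» (`PalasekTowerLundgrenChildLaws`, ecbridge-8 g5). D4
(`PalasekTowerLundgrenChildWindowBand`, g8) proved that after the N-2′ compaction budget EVERY pointwise bound `L`
of `‖∇u(t, ·)‖` of the child's full strained flow has `L ≥ ΓλA_k/(16πρ)`, whatever the profile
(`_childStrain_floor_of_budget_anyProfile`). In the register's units this is a threshold on the product of the
circulation number `C` and the ledger-to-core area ratio `x_k = λA_k/N_{k+1}² = λN_k^{β−2b}`
(`PalasekTowerChildCoreLedgerDisc._coreRatio_eq`, ecbridge-8 g8 D6; = `λ` × the DC1 margin `N_k^{β−2b}` of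
`PalasekTowerBurgersNumberStrain`, g3), because `ΓλA_k ≥ C·λA_kN_{k+1}^{β−2} = C·x_k·A_{k+1}`
(`_burgers_strain_scaling`):

* **`palasekTowerBreakdown_anyProfile_strainFloor_threshold`** — setting of `_childStrain_floor_of_budget_anyProfile`
  plus `Γ ≥ C·N_{k+1}^{β−2}`: **`16πρ·c₁ ≤ C·x_k` ⇒ every gradient bound `L` has `c₁A_{k+1} ≤ L`** — i.e. the
  supremum of `‖∇u(t, ·)‖` is at least the strain floor of level `k + 1`, for ANY co-signed profile;
* `palasekTowerBreakdown_anyProfile_strainFloor_threshold_wide_two` — wide rates, `k = 2` (`x_2 > 1.95λ`, from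
  `N_2 > 820 > 1.95^{10}`; cf. `wide_coreRatio_two_bounds` of D6): **`C·λ ≥ 25.9·ρ·c₁`** suffices.

Reading (numbers; `c₁ = 1`): the Burgers child meets the strain floor ON ITS AXIS iff `C·x_k ≥ 8π`
(`_burgers_strainFloor_axis`, g3: `Cλ ≥ 12.9` at `k = 2`); the any-profile certificate needs `C·x_k ≥ 16πρ`
(`Cλ ≥ 25.8ρ` at `k = 2`) — ABOVE the Burgers speed band `C ∈ [14.2, 21.2]` (`P ∈ [19.9, 29.6]`) at `k = 2`,
`λ = 1`, `ρ ≥ 1`: the any-profile strain floor is certified on the band only from `x_k ≥ 16πρ/14.2 ≈ 3.5ρ`, i.e.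
`N_k^{1/10} ≥ 3.5ρ/λ` (`k ≈ 9` on wide at `λ = ρ = 1`), while the Burgers child has it from `k = 2`. The factor
`2ρ` between the two is the bathtub floor (peak `≥ ΓλA_k/(8πρ)`, half the Burgers peak up to `ρ`) times
`|ω_z| ≤ 2‖∇u‖`.

WHAT THIS IS NOT: not NS about any registered flow — exact INFINITE-ENERGY Lundgren flows, no registered stage;
nothing is asserted about `StrainFloorAt`, `ReadoutFloors` or any crux; the identification is a MODEL step.

References: P. G. Saffman, *Vortex Dynamics*, CUP 1992, §13.3 (26)–(31) [cite: Saffman1992, §13.3 eqs. (26)–(31)];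
A. J. Majda, A. L. Bertozzi, CUP 2002, §1.1 (1.11) [cite: MajdaBertozziCUP2002, §1.1 eq. (1.11)]; E. H. Lieb,
M. Loss, *Analysis*, AMS 2001, Thm. 1.14 [cite: LiebLoss2001, Thm. 1.14]; S. Palasek, arXiv:2605.13827, §3 (3.2)
[cite: Palasek2026ElementaryModel, §3 (3.2)].
-/

namespace Summit.NavierStokesRegularity.FluidComputer.PalasekTowerClayBridge

open Real Set MeasureTheory
open Literature.Analysis.FluidPDE Literature.Analysis.FluidPDE.Lundgren

variable {S S' : Set ℝ}
  {v : ℝ → EuclideanSpace ℝ (Fin 2) → EuclideanSpace ℝ (Fin 2)}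
  {q : ℝ → EuclideanSpace ℝ (Fin 2) → ℝ} {w : ℝ → EuclideanSpace ℝ (Fin 2) → ℝ}

/-- **THE ANY-PROFILE STRAIN FLOOR IN REGISTER UNITS** (`ν = 1`, host strain `λA_k`, tolerance `ρ > 1`; setting
of `_childStrain_floor_of_budget_anyProfile`: co-signed child, `Γ > 0`, core fatter than the tolerated one, N-2′
budget delivered, circulation on the core-ledger scale `Γ ≥ C·N_{k+1}^{β−2}`): **if `16πρ·c₁ ≤ C·x_k`,
`x_k = λN_k^{β−2b}`, then EVERY pointwise bound `L` of `‖∇u(t, ·)‖` of the child's strained flow has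
`c₁·A_{k+1} ≤ L`** — the strain floor of level `k + 1` is met somewhere up to every tolerance, for ANY
co-signed profile (`L ≥ ΓλA_k/(16πρ) ≥ C·x_k·A_{k+1}/(16πρ)`). -/
theorem palasekTowerBreakdown_anyProfile_strainFloor_threshold (R : TowerRates) (k : ℕ) {l : ℝ}
    (hl : 0 < l) (hS' : Convex ℝ S') (hv : IsClassicalNSSolutionOn S' 1 0 v q)
    (hω : HasUniformRapidDecayOn S' (fun σ η => PlanarEigenmode.vorticity (v σ) η))
    (hBS : ∀ σ ∈ S', ∀ η, v σ η = biotSavart2D (PlanarEigenmode.vorticity (v σ)) η)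
    (hw : IsSmoothSpaceTimeOn S' w)
    (hmaps : MapsTo (fun t => (exp (l * R.A k * t) - 1) / (l * R.A k)) S S') (h0 : (0 : ℝ) ∈ S)
    {t : ℝ} (ht : t ∈ S) (ht0 : 0 ≤ t) (z₀ z : ℝ)
    (hpos : ∀ x : EuclideanSpace ℝ (Fin 3), 0 ≤ curl (velocity (fun _ => l * R.A k)
          (fun t y => exp (l * R.A k * t / 2) •
            v ((exp (l * R.A k * t) - 1) / (l * R.A k)) (exp (l * R.A k * t / 2) • y))
          (fun t y => exp (-(l * R.A k * t)) •
            w ((exp (l * R.A k * t) - 1) / (l * R.A k)) (exp (l * R.A k * t / 2) • y)) 0) x 2)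
    (hΓ : 0 < ∫ y : EuclideanSpace ℝ (Fin 2),
        curl (velocity (fun _ => l * R.A k)
          (fun t y => exp (l * R.A k * t / 2) •
            v ((exp (l * R.A k * t) - 1) / (l * R.A k)) (exp (l * R.A k * t / 2) • y))
          (fun t y => exp (-(l * R.A k * t)) •
            w ((exp (l * R.A k * t) - 1) / (l * R.A k)) (exp (l * R.A k * t / 2) • y)) 0)
          (embedXY y + z₀ • eZ) 2)
    {ρ : ℝ} (hρ : 1 < ρ)
    (hfat : ρ * (1 / (l * R.A k)) < (∫ y : EuclideanSpace ℝ (Fin 2), ‖y‖ ^ 2 *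
        curl (velocity (fun _ => l * R.A k)
          (fun t y => exp (l * R.A k * t / 2) •
            v ((exp (l * R.A k * t) - 1) / (l * R.A k)) (exp (l * R.A k * t / 2) • y))
          (fun t y => exp (-(l * R.A k * t)) •
            w ((exp (l * R.A k * t) - 1) / (l * R.A k)) (exp (l * R.A k * t / 2) • y)) 0)
          (embedXY y + z₀ • eZ) 2) /
        (4 * ∫ y : EuclideanSpace ℝ (Fin 2),
          curl (velocity (fun _ => l * R.A k)
          (fun t y => exp (l * R.A k * t / 2) •
            v ((exp (l * R.A k * t) - 1) / (l * R.A k)) (exp (l * R.A k * t / 2) • y))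
          (fun t y => exp (-(l * R.A k * t)) •
            w ((exp (l * R.A k * t) - 1) / (l * R.A k)) (exp (l * R.A k * t / 2) • y)) 0)
          (embedXY y + z₀ • eZ) 2))
    (hbud : log (((∫ y : EuclideanSpace ℝ (Fin 2), ‖y‖ ^ 2 *
        curl (velocity (fun _ => l * R.A k)
          (fun t y => exp (l * R.A k * t / 2) •
            v ((exp (l * R.A k * t) - 1) / (l * R.A k)) (exp (l * R.A k * t / 2) • y))
          (fun t y => exp (-(l * R.A k * t)) •
            w ((exp (l * R.A k * t) - 1) / (l * R.A k)) (exp (l * R.A k * t / 2) • y)) 0)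
          (embedXY y + z₀ • eZ) 2) /
        (4 * ∫ y : EuclideanSpace ℝ (Fin 2),
          curl (velocity (fun _ => l * R.A k)
          (fun t y => exp (l * R.A k * t / 2) •
            v ((exp (l * R.A k * t) - 1) / (l * R.A k)) (exp (l * R.A k * t / 2) • y))
          (fun t y => exp (-(l * R.A k * t)) •
            w ((exp (l * R.A k * t) - 1) / (l * R.A k)) (exp (l * R.A k * t / 2) • y)) 0)
          (embedXY y + z₀ • eZ) 2) * (l * R.A k) - 1) / (ρ - 1)) ≤ l * R.A k * t)
    {L : ℝ} (hL : ∀ x : EuclideanSpace ℝ (Fin 3), ‖fderiv ℝ (velocity (fun _ => l * R.A k)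
          (fun t y => exp (l * R.A k * t / 2) •
            v ((exp (l * R.A k * t) - 1) / (l * R.A k)) (exp (l * R.A k * t / 2) • y))
          (fun t y => exp (-(l * R.A k * t)) •
            w ((exp (l * R.A k * t) - 1) / (l * R.A k)) (exp (l * R.A k * t / 2) • y)) t) x‖ ≤ L)
    {C c₁ : ℝ} (hCΓ : C * R.N (k + 1) ^ (R.β - 2) ≤ (∫ y : EuclideanSpace ℝ (Fin 2),
        curl (velocity (fun _ => l * R.A k)
          (fun t y => exp (l * R.A k * t / 2) •
            v ((exp (l * R.A k * t) - 1) / (l * R.A k)) (exp (l * R.A k * t / 2) • y))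
          (fun t y => exp (-(l * R.A k * t)) •
            w ((exp (l * R.A k * t) - 1) / (l * R.A k)) (exp (l * R.A k * t / 2) • y)) 0)
          (embedXY y + z₀ • eZ) 2))
    (hP : 16 * π * ρ * c₁ ≤ C * (l * R.N k ^ (R.β - 2 * R.b))) :
    c₁ * R.A (k + 1) ≤ L := by
  have hγ : 0 < l * R.A k := mul_pos hl (R.A_pos k)
  have hπ : 0 < π := pi_pos
  have hρ0 : 0 < ρ := by linarith
  have hA1 : 0 < R.A (k + 1) := R.A_pos _
  have h := palasekTowerBreakdown_childStrain_floor_of_budget_anyProfile R k hl hS' hv hω hBS hw hmaps h0 ht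
    ht0 z₀ z hpos hΓ hρ hfat hbud hL
  refine le_trans ?_ h
  have hxA := palasekTowerBreakdown_burgers_strain_scaling R k
  rw [le_div_iff₀ (by positivity)]
  -- `c₁ A_{k+1} · 16πρ ≤ C x_k A_{k+1} = C λA_k N_{k+1}^{β−2} ≤ Γ λA_k`
  calc c₁ * R.A (k + 1) * (16 * π * ρ) = 16 * π * ρ * c₁ * R.A (k + 1) := by ring
    _ ≤ C * (l * R.N k ^ (R.β - 2 * R.b)) * R.A (k + 1) := mul_le_mul_of_nonneg_right hP hA1.le
    _ = C * R.N (k + 1) ^ (R.β - 2) * (l * R.A k) := by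
        rw [show C * (l * R.N k ^ (R.β - 2 * R.b)) * R.A (k + 1) =
            C * l * (R.N k ^ (R.β - 2 * R.b) * R.A (k + 1)) by ring, ← hxA]
        ring
    _ ≤ _ := mul_le_mul_of_nonneg_right hCΓ hγ.le

/-- `x_2/λ = N_2^{β−2b} = N_2^{1/10} > 1.95` on the wide rates (`N_2 > 820 > 1.95^{10} = 794.3`; the two-sided
bracket `(1.95, 1.96)` is `wide_coreRatio_two_bounds` in `PalasekTowerChildCoreLedgerDisc`). [folklore] -/
private theorem wide_coreRatio_two_gt :
    1.95 < TowerRates.wide.N 2 ^ (TowerRates.wide.β - 2 * TowerRates.wide.b) := by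
  have hexp : TowerRates.wide.β - 2 * TowerRates.wide.b = ((10 : ℕ) : ℝ)⁻¹ := by
    norm_num [TowerRates.wide]
  have hN := TowerRates.wide_N_two_bounds.1
  have h1 : (1.95 : ℝ) ^ (10 : ℕ) < TowerRates.wide.N 2 := lt_trans (by norm_num) hN
  rw [hexp]
  calc (1.95 : ℝ) = ((1.95 : ℝ) ^ (10 : ℕ)) ^ (((10 : ℕ) : ℝ)⁻¹) :=
        (Real.pow_rpow_inv_natCast (by norm_num) (by norm_num)).symm
    _ < TowerRates.wide.N 2 ^ (((10 : ℕ) : ℝ)⁻¹) := Real.rpow_lt_rpow (by positivity) h1 (by norm_num)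

/-- **Wide rates, `k = 2`: `C·λ ≥ 25.9·ρ·c₁` certifies the any-profile strain floor** (`x_2 = λN_2^{1/10} > 1.95λ`,
`25.9·1.95 > 16π`; `c₁, ρ ≥ 0` for the monotonicity): the threshold hypothesis of
`_anyProfile_strainFloor_threshold` at `R = wide`, `k = 2`. Burgers child: `C·λ ≥ 12.9·c₁`
(`_burgers_strainFloor_axis_rigid`). -/
theorem palasekTowerBreakdown_anyProfile_strainFloor_threshold_wide_two {C l ρ c₁ : ℝ}
    (hρ : 0 ≤ ρ) (hc₁ : 0 ≤ c₁) (hP : 25.9 * ρ * c₁ ≤ C * l) :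
    16 * π * ρ * c₁ ≤ C * (l * TowerRates.wide.N 2 ^ (TowerRates.wide.β - 2 * TowerRates.wide.b)) := by
  have hlo := wide_coreRatio_two_gt
  have hπ : π < 3.141593 := pi_lt_d6
  have hCl : 0 ≤ C * l := le_trans (by positivity) hP
  calc 16 * π * ρ * c₁ ≤ 25.9 * ρ * c₁ * 1.95 := by nlinarith [mul_nonneg hρ hc₁]
    _ ≤ C * l * 1.95 := mul_le_mul_of_nonneg_right hP (by norm_num)
    _ ≤ C * l * TowerRates.wide.N 2 ^ (TowerRates.wide.β - 2 * TowerRates.wide.b) :=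
        mul_le_mul_of_nonneg_left hlo.le hCl
    _ = _ := by ring

end Summit.NavierStokesRegularity.FluidComputer.PalasekTowerClayBridge
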